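import Summits.AtomisticToContinuum.Crystallization.Theorems.FreeSplittingCertificatesStrictSplittingRuleP1BareWeightTranslate
import Summits.AtomisticToContinuum.Crystallization.Theorems.FreeSplittingCertificatesStrictSplittingRuleP1CellRadAll

/-!
# `StrictSplittingRule` (stmt-AtomisticToContinuum-12560): the vertex-quadrature defect of a cell AS AN EXACT QUADRATIC FORM in the element gradient — no majorant (P1 interpolant object, part 68)

Route `FreeSplittingCertificates`, crux r3 `StrictSplittingRule` (H12⋆ = `stub_coreJointCoercive`), unit b2b-freesplit-B gen 34.
VALUE = the repair of a mismatch between the kernel assembly and the certificate tier, found in gen 34's audit (HOME CERT §34).  The per-cell budget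
(B) of the kernel endpoint (parts 55–57, 60, 64) books the radial vertex-quadrature defect of cell `T` in CIRCUMRADIUS form `(∫_T ω)·ρ_T·|G|²_F`
(part 31, `tsum_p1SiteBare_le_rad`), whereas the interval tier (`cellval.py`, rule v31, CERT §31) certifies (B) with the per-cell MINIMUM of that form
and the `|T|/16` form — in 49 522 / 63 670 loaded cells (parity A) the `|T|/16` form is the one used, and with the circumradius form alone 1 870 (A) /
1 876 (B) cells exceed the budget at `f = 5/2` (worst `f_T ≈ 2.88`).  So the kernel hypothesis as stated was NOT the certified statement.  The cure is
to book the defect EXACTLY: for P1 vertex values (`v_m − v_{m'} = Gᵀ(y_m − y_{m'})`) the excess of the hat-weighted vertex quadrature over the cell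
integral is, by the variance identity (part 30),
  `Σ_m ∫_T λ_m q_{W}(v_m) − ∫_T q_W(Σ_m λ_m v_m) = ∫_T ½Σ_{m,m'} λ_mλ_{m'} q_{W(y)}(Gᵀ(y_m − y_{m'})) dy =: p1CellDefectG a h W T G`
— an explicit PSD quadratic form in the `3 × 3` gradient `G` with cell-integral coefficients (the same kind of integrals the flux engine encloses).
Both majorants the certificate uses are upper bounds of THIS form (circumradius: `p1CellDefectG_le_rad` below = part 31's pointwise bound; `|T|/16`:
`∫λ_mλ_{m'} ≤ |T|/16` + `sup ω|x|²`, parts 25c/28), so a per-cell budget stated with `p1CellDefectG` is exactly what `cellval.py` certifies, whichever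
majorant it picks per cell.  This file: the form, `vertex_quadrature_excess_eq_defect_p1RealCell` (the cell IDENTITY), nonnegativity, the circumradius
bound, and the global transfers `tsum_p1SiteBare_le_defect(_p1DispSite)` / `tsum_p1SiteBare_rad_le_defect_p1DispSite_translate` (Σ'_q Bare_q ≤ ∫q_W(ṽ) +
Σ'_T p1CellDefectG(G_T); summability of the exact defect family from the circumradius majorant).  Parts 69–72 re-thread the assembly on it.
NOT a proof of H12⋆, NOT summit progress.  [folklore: P1 finite elements]
-/

noncomputable section

open Set Function Metric MeasureTheory Filter Topology
open scoped BigOperators NNReal ENNReal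

namespace Summit.AtomisticToContinuum.Crystallization.Theorems.StrictSplittingRuleBirth

open Literature.MathematicalPhysics.StatisticalMechanics
open Summit.AtomisticToContinuum.Crystallization.Theorems.PalmUnimodularRigidity.LayeredLawsSelectHcp

/-! ## The exact defect form -/

/-- Edge vector of cell `i` between vertices `m` and `m'`, contracted with the gradient: `(Gᵀ(y_m − y_{m'}))_k`. [folklore] -/
def p1EdgeGrad (a h : ℝ) (i : (ℤ × ℤ × ℤ) × Fin 6) (m m' : Fin 4) (G : Fin 3 → Fin 3 → ℝ) (k : Fin 3) : ℝ :=
  (hcpSite a h (i.1 + p1VertOff (p1Par i.1) i.2 m) 0 - hcpSite a h (i.1 + p1VertOff (p1Par i.1) i.2 m') 0) * G 0 k +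
    (hcpSite a h (i.1 + p1VertOff (p1Par i.1) i.2 m) 1 - hcpSite a h (i.1 + p1VertOff (p1Par i.1) i.2 m') 1) * G 1 k +
    (hcpSite a h (i.1 + p1VertOff (p1Par i.1) i.2 m) 2 - hcpSite a h (i.1 + p1VertOff (p1Par i.1) i.2 m') 2) * G 2 k

/-- **THE EXACT VERTEX-QUADRATURE DEFECT of cell `T` for the weight `W` and the element gradient `G`**:
`∫_T ½Σ_{m,m'} λ_m(y)λ_{m'}(y)·q_{W(y)}(Gᵀ(y_m − y_{m'})) dy`. [folklore] -/
def p1CellDefectG (a h : ℝ) (W : (Fin 3 → ℝ) → Fin 3 → Fin 3 → ℝ) (i : (ℤ × ℤ × ℤ) × Fin 6) (G : Fin 3 → Fin 3 → ℝ) : ℝ :=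
  ∫ y in p1RealCell a h i, 1 / 2 * ∑ m : Fin 4, ∑ m' : Fin 4, p1Lam a h i m y * p1Lam a h i m' y * p1Quad3 (W y) (p1EdgeGrad a h i m m' G)

/-- The exact defect is nonnegative for a cellwise positive semidefinite weight. -/
theorem p1CellDefectG_nonneg {a h : ℝ} (W : (Fin 3 → ℝ) → Fin 3 → Fin 3 → ℝ) (i : (ℤ × ℤ × ℤ) × Fin 6)
    (hW0 : ∀ y ∈ p1RealCell a h i, ∀ u : Fin 3 → ℝ, 0 ≤ p1Quad3 (W y) u) (G : Fin 3 → Fin 3 → ℝ) :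
    0 ≤ p1CellDefectG a h W i G := by
  refine setIntegral_nonneg (isClosed_p1RealCell a h i).measurableSet fun y hy => ?_
  refine mul_nonneg (by norm_num) (Finset.sum_nonneg fun m _ => Finset.sum_nonneg fun m' _ => ?_)
  exact mul_nonneg (mul_nonneg (p1Lam_nonneg_of_mem hy m) (p1Lam_nonneg_of_mem hy m')) (hW0 y hy _)

/-- **THE CELL IDENTITY**: for P1 vertex values (`v_m − v_{m'} = Gᵀ(y_m − y_{m'})`),
`Σ_m ∫_T λ_m·q_W(v_m) = ∫_T q_W(Σ_m λ_m v_m) + p1CellDefectG W T G` (variance identity, integrated). -/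
theorem vertex_quadrature_excess_eq_defect_p1RealCell {a h : ℝ} (ha : 0 < a) (hh : 0 < h) (i : (ℤ × ℤ × ℤ) × Fin 6)
    (W : (Fin 3 → ℝ) → Fin 3 → Fin 3 → ℝ) (hWc : ∀ k l, Continuous fun x => W x k l)
    (G : Fin 3 → Fin 3 → ℝ) (v : Fin 4 → Fin 3 → ℝ) (hv : ∀ m m' : Fin 4, ∀ k : Fin 3, v m k - v m' k = p1EdgeGrad a h i m m' G k) :
    ∑ m, ∫ y in p1RealCell a h i, p1Lam a h i m y * p1Quad3 (W y) (v m) =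
      (∫ y in p1RealCell a h i, p1Quad3 (W y) (fun k => ∑ m, p1Lam a h i m y * v m k)) + p1CellDefectG a h W i G := by
  have ha' := ha.ne'
  have hh' := hh.ne'
  have hK := isCompact_p1RealCell ha' hh' i
  have hmeas : MeasurableSet (p1RealCell a h i) := (isClosed_p1RealCell a h i).measurableSet
  have hcl : ∀ m, Continuous (p1Lam a h i m) := continuous_p1Lam a h i
  have hq : ∀ u : Fin 3 → ℝ, Continuous fun y => p1Quad3 (W y) u := fun u =>
    continuous_p1Quad3_of_continuous hWc (u := fun _ => u) fun k => continuous_const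
  have iA : ∀ m, IntegrableOn (fun y => p1Lam a h i m y * p1Quad3 (W y) (v m)) (p1RealCell a h i) volume := fun m =>
    ((hcl m).mul (hq _)).continuousOn.integrableOn_compact hK
  have iQ : IntegrableOn (fun y => p1Quad3 (W y) (fun k => ∑ m, p1Lam a h i m y * v m k)) (p1RealCell a h i) volume := by
    have : Continuous fun y => p1Quad3 (W y) (fun k => ∑ m, p1Lam a h i m y * v m k) := by
      refine continuous_p1Quad3_of_continuous hWc fun k => ?_
      simp only [Fin.sum_univ_four]
      fun_prop
    exact this.continuousOn.integrableOn_compact hK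
  have iS : IntegrableOn (fun y => ∑ m, p1Lam a h i m y * p1Quad3 (W y) (v m)) (p1RealCell a h i) volume :=
    integrable_finsetSum _ fun m _ => iA m
  -- the vertex differences are the edge gradients
  have hvm : ∀ m m' : Fin 4, v m - v m' = p1EdgeGrad a h i m m' G := fun m m' => funext fun k => by
    rw [Pi.sub_apply]; exact hv m m' k
  -- pointwise variance identity
  have hpt : ∀ y, (∑ m, p1Lam a h i m y * p1Quad3 (W y) (v m)) - p1Quad3 (W y) (fun k => ∑ m, p1Lam a h i m y * v m k) =
      1 / 2 * ∑ m, ∑ m', p1Lam a h i m y * p1Lam a h i m' y * p1Quad3 (W y) (p1EdgeGrad a h i m m' G) := by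
    intro y
    have h1 := p1_variance_identity (W y) (fun m => p1Lam a h i m y) (sum_p1Lam_eq_one a h i y) v
    simp only [hvm] at h1
    exact h1
  have hdiff : (∫ y in p1RealCell a h i, ∑ m, p1Lam a h i m y * p1Quad3 (W y) (v m)) -
      ∫ y in p1RealCell a h i, p1Quad3 (W y) (fun k => ∑ m, p1Lam a h i m y * v m k) = p1CellDefectG a h W i G := by
    rw [← integral_sub iS iQ]
    exact setIntegral_congr_fun hmeas fun y _ => hpt y
  rw [← integral_finsetSum _ fun m _ => iA m]
  linarith [hdiff]

/-- **The circumradius form bounds the exact defect**: with a pointwise majorant `q_{W(y)}(u) ≤ ω(y)|u|²` on the cell and all four vertices within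
`|·|² ≤ ρ` of a centre, `p1CellDefectG W T G ≤ (∫_T ω)·ρ·|G|²_F` (part 31's pointwise bound, integrated). -/
theorem p1CellDefectG_le_rad {a h : ℝ} (ha : 0 < a) (hh : 0 < h) (i : (ℤ × ℤ × ℤ) × Fin 6)
    (W : (Fin 3 → ℝ) → Fin 3 → Fin 3 → ℝ) (hWc : ∀ k l, Continuous fun x => W x k l)
    (hW0 : ∀ y ∈ p1RealCell a h i, ∀ u : Fin 3 → ℝ, 0 ≤ p1Quad3 (W y) u) {ω : (Fin 3 → ℝ) → ℝ} (hωc : Continuous ω)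
    (hω : ∀ y ∈ p1RealCell a h i, ∀ u : Fin 3 → ℝ, p1Quad3 (W y) u ≤ ω y * (u 0 ^ 2 + u 1 ^ 2 + u 2 ^ 2))
    (G : Fin 3 → Fin 3 → ℝ) {c : Fin 3 → ℝ} {ρ : ℝ}
    (hρ : ∀ m : Fin 4, fpSq (fun k => hcpSite a h (i.1 + p1VertOff (p1Par i.1) i.2 m) k - c k) ≤ ρ) :
    p1CellDefectG a h W i G ≤ (∫ y in p1RealCell a h i, ω y) * (ρ * fpFrob G) := by
  have ha' := ha.ne'
  have hh' := hh.ne'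
  have hK := isCompact_p1RealCell ha' hh' i
  have hmeas : MeasurableSet (p1RealCell a h i) := (isClosed_p1RealCell a h i).measurableSet
  have hcl : ∀ m, Continuous (p1Lam a h i m) := continuous_p1Lam a h i
  have hq : ∀ u : Fin 3 → ℝ, Continuous fun y => p1Quad3 (W y) u := fun u =>
    continuous_p1Quad3_of_continuous hWc (u := fun _ => u) fun k => continuous_const
  -- P1 vertex values realising `G`: `v_m = Gᵀ y_m`
  set v : Fin 4 → Fin 3 → ℝ := fun m k =>
    hcpSite a h (i.1 + p1VertOff (p1Par i.1) i.2 m) 0 * G 0 k + hcpSite a h (i.1 + p1VertOff (p1Par i.1) i.2 m) 1 * G 1 k +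
      hcpSite a h (i.1 + p1VertOff (p1Par i.1) i.2 m) 2 * G 2 k with hvdef
  have hv : ∀ m m' : Fin 4, ∀ k : Fin 3, v m k - v m' k =
      (hcpSite a h (i.1 + p1VertOff (p1Par i.1) i.2 m) 0 - hcpSite a h (i.1 + p1VertOff (p1Par i.1) i.2 m') 0) * G 0 k +
      (hcpSite a h (i.1 + p1VertOff (p1Par i.1) i.2 m) 1 - hcpSite a h (i.1 + p1VertOff (p1Par i.1) i.2 m') 1) * G 1 k +
      (hcpSite a h (i.1 + p1VertOff (p1Par i.1) i.2 m) 2 - hcpSite a h (i.1 + p1VertOff (p1Par i.1) i.2 m') 2) * G 2 k := by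
    intro m m' k; simp only [hvdef]; ring
  have hvm : ∀ m m' : Fin 4, p1EdgeGrad a h i m m' G = v m - v m' := fun m m' => funext fun k => by
    rw [Pi.sub_apply, hv m m' k]; rfl
  have iD : IntegrableOn (fun y => 1 / 2 * ∑ m, ∑ m', p1Lam a h i m y * p1Lam a h i m' y * p1Quad3 (W y) (p1EdgeGrad a h i m m' G))
      (p1RealCell a h i) volume :=
    (integrable_finsetSum _ fun m _ => integrable_finsetSum _ fun m' _ =>
      (((hcl m).mul (hcl m')).mul (hq _)).continuousOn.integrableOn_compact hK).const_mul _
  have iω : IntegrableOn (fun y => ω y * (ρ * fpFrob G)) (p1RealCell a h i) volume :=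
    (hωc.mul continuous_const).continuousOn.integrableOn_compact hK
  have hdom : ∀ y ∈ p1RealCell a h i,
      1 / 2 * ∑ m, ∑ m', p1Lam a h i m y * p1Lam a h i m' y * p1Quad3 (W y) (p1EdgeGrad a h i m m' G) ≤ ω y * (ρ * fpFrob G) := by
    intro y hy
    have h := p1_defect_pointwise_rad ha' hh' hy (W y) (hW0 y hy) (hω y hy) G v hv hρ
    simp only [hvm]
    linarith
  unfold p1CellDefectG
  refine (setIntegral_mono_on iD iω hmeas hdom).trans (le_of_eq ?_)
  rw [integral_mul_const]

/-! ## The global sums -/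

/-- **THE GLOBAL BARE-DEMAND TRANSFER WITH THE EXACT DEFECT** (radial-deficit half): for a continuous weight `0 ⪯ W(y)`, lattice values `V`
with interpolant `ṽ = p1Field a h V`, `q_W(ṽ)` integrable and the exact defect family summable,
`Σ'_q p1SiteBare q ≤ ∫ q_W(ṽ) + Σ'_T p1CellDefectG W T (G_T)`, `G_T = p1CellGrad a h V T`.  NOT a proof of H12⋆, NOT summit progress. -/
theorem tsum_p1SiteBare_le_defect {a h : ℝ} (ha : 0 < a) (hh : 0 < h) (W : (Fin 3 → ℝ) → Fin 3 → Fin 3 → ℝ)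
    (hWc : ∀ k l, Continuous fun x => W x k l) (hW0 : ∀ y : Fin 3 → ℝ, ∀ u : Fin 3 → ℝ, 0 ≤ p1Quad3 (W y) u)
    (V : ℤ × ℤ × ℤ → (Fin 3 → ℝ)) (hint : Integrable fun y => p1Quad3 (W y) (p1Field a h V y))
    (hdef : Summable fun i => p1CellDefectG a h W i (p1CellGrad a h V i)) :
    Summable (p1SiteBare a h W V) ∧
    ∑' q, p1SiteBare a h W V q ≤ (∫ y, p1Quad3 (W y) (p1Field a h V y)) + ∑' i, p1CellDefectG a h W i (p1CellGrad a h V i) := by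
  have ha' := ha.ne'
  have hh' := hh.ne'
  -- per-cell identity
  have hcell : ∀ i, ∑ m, p1CellBare a h W V i m ≤
      (∫ y in p1RealCell a h i, p1Quad3 (W y) (p1Field a h V y)) + p1CellDefectG a h W i (p1CellGrad a h V i) := by
    intro i
    have h1 := vertex_quadrature_excess_eq_defect_p1RealCell ha hh i W hWc (p1CellGrad a h V i) (p1CellVals V i)
      (fun m m' k => p1CellVals_sub_eq_grad ha' hh' V i m m' k)
    have h2 : ∫ y in p1RealCell a h i, p1Quad3 (W y) (fun k => ∑ m, p1Lam a h i m y * p1CellVals V i m k) =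
        ∫ y in p1RealCell a h i, p1Quad3 (W y) (p1Field a h V y) :=
      setIntegral_congr_fun (isClosed_p1RealCell a h i).measurableSet fun y hy => by rw [p1Field_eq_sum_p1Lam V hy]
    unfold p1CellBare
    rw [← h2]
    exact h1.le
  -- the three families
  have hB : HasSum (fun i => ∫ y in p1RealCell a h i, p1Quad3 (W y) (p1Field a h V y)) (∫ y, p1Quad3 (W y) (p1Field a h V y)) :=
    hasSum_setIntegral_p1RealCell ha' hh' hint
  have hA0 : ∀ i, 0 ≤ ∑ m, p1CellBare a h W V i m := fun i => Finset.sum_nonneg fun m _ => p1CellBare_nonneg V i (fun y _ u => hW0 y u) m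
  have hsum : Summable fun i => (∫ y in p1RealCell a h i, p1Quad3 (W y) (p1Field a h V y)) + p1CellDefectG a h W i (p1CellGrad a h V i) :=
    hB.summable.add hdef
  have hA : Summable fun i => ∑ m, p1CellBare a h W V i m := Summable.of_nonneg_of_le hA0 hcell hsum
  -- regroup the vertex family to sites
  have hg0 : ∀ n π m, 0 ≤ p1CellBare a h W V (n, π) m := fun n π m => p1CellBare_nonneg V (n, π) (fun y _ u => hW0 y u) m
  have hAf : HasSum (fun n : ℤ × ℤ × ℤ => ∑ π : Fin 6, ∑ m : Fin 4, p1CellBare a h W V (n, π) m) (∑' i, ∑ m, p1CellBare a h W V i m) :=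
    hA.hasSum.prod_fiberwise fun n => hasSum_fintype _
  obtain ⟨hS, hEq⟩ := tsum_cellVertex_eq_tsum_site (g := fun n π m => p1CellBare a h W V (n, π) m) hg0 hAf.summable
  have hSite : (fun q => ∑ o ∈ p1Corners, ∑ π : Fin 6, ∑ m : Fin 4,
      if p1VertOff (p1Par (q - o)) π m = o then p1CellBare a h W V (q - o, π) m else 0) = p1SiteBare a h W V := by
    funext q; rfl
  rw [hSite] at hS hEq
  refine ⟨hS, ?_⟩
  rw [← hEq, hAf.tsum_eq]
  calc ∑' i, ∑ m, p1CellBare a h W V i m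
      ≤ ∑' i, ((∫ y in p1RealCell a h i, p1Quad3 (W y) (p1Field a h V y)) + p1CellDefectG a h W i (p1CellGrad a h V i)) :=
        Summable.tsum_le_tsum hcell hA hsum
    _ = (∑' i, ∫ y in p1RealCell a h i, p1Quad3 (W y) (p1Field a h V y)) + ∑' i, p1CellDefectG a h W i (p1CellGrad a h V i) :=
        hB.summable.tsum_add hdef
    _ = (∫ y, p1Quad3 (W y) (p1Field a h V y)) + ∑' i, p1CellDefectG a h W i (p1CellGrad a h V i) := by rw [hB.tsum_eq]

/-- **The exact defect family of the far-ledger field is summable** (dominated by the circumradius family, circumradii from the honeycomb's table). -/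
theorem summable_defect_p1DispSite {a h : ℝ} (ha : 0 < a) (hh : 0 < h) (W : (Fin 3 → ℝ) → Fin 3 → Fin 3 → ℝ)
    (hWc : ∀ k l, Continuous fun x => W x k l) (hW0 : ∀ y : Fin 3 → ℝ, ∀ u : Fin 3 → ℝ, 0 ≤ p1Quad3 (W y) u)
    {ω : (Fin 3 → ℝ) → ℝ} (hωc : Continuous ω)
    (hω : ∀ y : Fin 3 → ℝ, ∀ u : Fin 3 → ℝ, p1Quad3 (W y) u ≤ ω y * (u 0 ^ 2 + u 1 ^ 2 + u 2 ^ 2)) (hωi : Integrable ω)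
    (U : ℤ × ℤ × ℤ → (Fin 3 → ℝ)) (hU : (support U).Finite) (b₀ : Fin 3 → ℝ) (A : Fin 3 → Fin 3 → ℝ) :
    Summable fun i => p1CellDefectG a h W i (p1CellGrad a h (fun n k => p1DispSite a h U b₀ A n k) i) := by
  have hh' := hh.ne'
  have hω0 : ∀ y, 0 ≤ ω y := fun y => p1Quad3_majorant_nonneg (hW0 y) (hω y)
  -- circumradius data from the honeycomb's table
  set ρ : (ℤ × ℤ × ℤ) × Fin 6 → ℝ := fun i =>
    if i.2 ≤ 1 then a ^ 2 / 3 + ((h ^ 2 - a ^ 2 / 3) / (2 * h)) ^ 2 else a ^ 2 / 3 + h ^ 2 / 4 with hρdef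
  have hρ₀ : ∀ i, |ρ i| ≤ a ^ 2 / 3 + ((h ^ 2 - a ^ 2 / 3) / (2 * h)) ^ 2 + (a ^ 2 / 3 + h ^ 2 / 4) := by
    intro i
    simp only [hρdef]
    split_ifs
    · rw [abs_of_nonneg (by positivity)]
      linarith [sq_nonneg a, sq_nonneg h]
    · rw [abs_of_nonneg (by positivity)]
      nlinarith [sq_nonneg a, sq_nonneg ((h ^ 2 - a ^ 2 / 3) / (2 * h))]
  have hmaj := summable_radDefect_p1DispSite ha hh U hU b₀ A hω0 hωi ρ hρ₀
  refine Summable.of_nonneg_of_le (fun i => p1CellDefectG_nonneg W i (fun y _ u => hW0 y u) _) (fun i => ?_) hmaj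
  obtain ⟨c, hc⟩ := exists_p1CellCenter a h hh' i
  exact p1CellDefectG_le_rad ha hh i W hWc (fun y _ u => hW0 y u) hωc (fun y _ u => hω y u) _ hc

/-- **RADIAL DEFICIT WITH THE EXACT DEFECT, re-centred at `y₀`**: for `c ≥ 0`, `0 < S₁ < S₂` and `U` finitely supported,
`Σ'_q p1SiteBare[W_rad(· − y₀)](V)_q ≤ ∫ cχ(x)²s⁻⁵⟪x, p1Disp(y₀ + x)⟫²dx + Σ'_T p1CellDefectG[W_rad(· − y₀)](T)(G_T(U) − A)` (the defect family summable).
NOT a proof of H12⋆, NOT summit progress. -/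
theorem tsum_p1SiteBare_rad_le_defect_p1DispSite_translate {a h c S1 S2 : ℝ} (ha : 0 < a) (hh : 0 < h) (hc : 0 ≤ c) (hS1 : 0 < S1)
    (hS12 : S1 < S2) (U : ℤ × ℤ × ℤ → (Fin 3 → ℝ)) (hU : (support U).Finite) (b₀ : Fin 3 → ℝ) (A : Fin 3 → Fin 3 → ℝ) (y₀ : Fin 3 → ℝ) :
    Summable (fun i => p1CellDefectG a h (fun y k l => c * fpChi S1 S2 (y - y₀) ^ 2 * (fpSq (y - y₀))⁻¹ ^ 5 * ((y - y₀) k * (y - y₀) l)) i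
      (fun j k => p1CellGrad a h U i j k - A j k)) ∧
    Summable (p1SiteBare a h (fun y k l => c * fpChi S1 S2 (y - y₀) ^ 2 * (fpSq (y - y₀))⁻¹ ^ 5 * ((y - y₀) k * (y - y₀) l))
      (fun n k => p1DispSite a h U b₀ A n k)) ∧
    ∑' q, p1SiteBare a h (fun y k l => c * fpChi S1 S2 (y - y₀) ^ 2 * (fpSq (y - y₀))⁻¹ ^ 5 * ((y - y₀) k * (y - y₀) l))
        (fun n k => p1DispSite a h U b₀ A n k) q ≤
      (∫ x, c * fpChi S1 S2 x ^ 2 * (fpSq x)⁻¹ ^ 5 * fpDot x (p1Disp a h U b₀ A (y₀ + x)) ^ 2) +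
        ∑' i, p1CellDefectG a h (fun y k l => c * fpChi S1 S2 (y - y₀) ^ 2 * (fpSq (y - y₀))⁻¹ ^ 5 * ((y - y₀) k * (y - y₀) l)) i
          (fun j k => p1CellGrad a h U i j k - A j k) := by
  set W : (Fin 3 → ℝ) → Fin 3 → Fin 3 → ℝ := fun y k l => c * fpChi S1 S2 (y - y₀) ^ 2 * (fpSq (y - y₀))⁻¹ ^ 5 * ((y - y₀) k * (y - y₀) l)
    with hW
  have hWc : ∀ k l, Continuous fun y => W y k l := continuous_radWeight_translate hS1 hS12 c y₀
  have hW0 : ∀ y u, 0 ≤ p1Quad3 (W y) u := fun y u => p1Quad3_radWeight_nonneg hc S1 S2 (y - y₀) u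
  have hωc := continuous_bareMajorant_translate hS1 hS12 c y₀
  have hWle : ∀ y u, p1Quad3 (W y) u ≤ (c * fpChi S1 S2 (y - y₀) ^ 2 * (fpSq (y - y₀))⁻¹ ^ 4) * (u 0 ^ 2 + u 1 ^ 2 + u 2 ^ 2) :=
    fun y u => p1Quad3_radWeight_le hc S1 S2 (y - y₀) u
  have hωi := integrable_bareMajorant_growth_translate hS1 hS12 c hc y₀
  have hω0 : ∀ y, 0 ≤ c * fpChi S1 S2 (y - y₀) ^ 2 * (fpSq (y - y₀))⁻¹ ^ 4 := fun y => p1Quad3_majorant_nonneg (hW0 y) (hWle y)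
  have hωi' : Integrable fun y => c * fpChi S1 S2 (y - y₀) ^ 2 * (fpSq (y - y₀))⁻¹ ^ 4 := by
    refine Integrable.mono' hωi hωc.aestronglyMeasurable (Eventually.of_forall fun y => ?_)
    rw [Real.norm_eq_abs, abs_of_nonneg (hω0 y)]
    have : (1 : ℝ) ≤ (1 + ‖y‖) ^ 2 := by nlinarith [norm_nonneg y]
    nlinarith [hω0 y]
  have hint := integrable_p1Quad3_p1Field_p1DispSite ha hh W hWc hW0 hWle hωi U hU b₀ A
  have hdef := summable_defect_p1DispSite ha hh W hWc hW0 hωc hWle hωi' U hU b₀ A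
  simp only [p1CellGrad_p1DispSite ha hh] at hdef
  have hmain := tsum_p1SiteBare_le_defect ha hh W hWc hW0 _ hint (by simpa only [p1CellGrad_p1DispSite ha hh] using hdef)
  rw [← p1Disp_eq_p1Field ha.ne' hh.ne' U b₀ A] at hmain
  simp only [p1CellGrad_p1DispSite ha hh] at hmain
  have hI : (∫ y, p1Quad3 (W y) (p1Disp a h U b₀ A y)) = ∫ x, c * fpChi S1 S2 x ^ 2 * (fpSq x)⁻¹ ^ 5 * fpDot x (p1Disp a h U b₀ A (y₀ + x)) ^ 2 := by
    rw [← integral_add_left_eq_self (μ := volume) (fun y => p1Quad3 (W y) (p1Disp a h U b₀ A y)) y₀]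
    refine integral_congr_ae (Eventually.of_forall fun x => ?_)
    simp only [hW, add_sub_cancel_left, p1Quad3_radWeight]
  rw [hI] at hmain
  exact ⟨hdef, hmain⟩

end Summit.AtomisticToContinuum.Crystallization.Theorems.StrictSplittingRuleBirth

end
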